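import Summits.ValiantsHypothesis.ValiantsHypothesis.Theses.DetQP
import Summits.ValiantsHypothesis.ValiantsHypothesis.Theorems.DetqpThesis.Negative.IffPerNotVQP
import Literature.Computability.AlgebraicComplexity.DeterminantalComplexityProofs
import Literature.Computability.AlgebraicComplexity.VPDeterminantalQPProofs

/-!
# Crux `DetQP.DetqpThesis` (stmt-ValiantsHypothesis-0315), line `Sketch`
# (idea `four-dimensional-determinant`) — stub `stub_detqpThesis_of_isPProjection` (S4):
# qp ∘ poly = qp

The generic transfer step of the line.  If a family `g = (gₙ)` (in arbitrary variable sets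
`σ n`) is a p-projection of the permanent family `per = (perPoly (Fin n) ℂ)ₙ` and
`n ↦ dc(gₙ)` is NOT quasi-polynomially bounded, then neither is `n ↦ dc(perₙ)`, i.e. the crux
`DetQP.DetqpThesis = ¬ IsQPBounded (fun n => determinantalComplexity (perPoly (Fin n) ℂ))`
holds.  The statement is generic in `(σ, g)`; the line feeds it with the four-dimensional
hyperdeterminant family, but nothing here depends on that choice.

Proof.  Suppose `dc(perₘ) ≤ 2^((log₂ m + c)^c)` for all `m`.  From `hg` obtain a p-bounded `t`
with `gₙ` a projection of `per_{t n}`.  Determinantal complexity is monotone under projection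
(`determinantalComplexity_le_of_isProjection_holds`, Bürgisser 2000, §2.5), so
`dc(gₙ) ≤ dc(per_{t n}) ≤ 2^((log₂ (t n) + c)^c)`.  Since `t` is p-bounded,
`t n < 2^((log₂ n + 1) A)` for a constant `A ≥ 1`, so `log₂ (t n) < (log₂ n + 1) A` and the
exponent is at most `(log₂ n + c')^c'` with `c' = A + 2c + 1`: this template arithmetic
(qp ∘ poly = qp) is the landed `qpBound_comp_le` of
`Theorems/DetqpThesis/Negative/IffPerNotVQP.lean` (namespace
`Summit.ValiantsHypothesis.Theorems.DetqpThesis.Negative`), imported rather than re-proved.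
Hence `dc ∘ g` is quasi-polynomially bounded, contradicting `hX`.

No new definitions; no named fact is used undischarged (the monotonicity of `dc` enters through
its discharge `determinantalComplexity_le_of_isProjection_holds`).
-/

noncomputable section

-- single-conjunct layout: Sub = Summit, duplicated namespace component intended
set_option linter.dupNamespace false

namespace Summit.ValiantsHypothesis.ValiantsHypothesis.Theorems.DetQPDetqpThesis

open Literature.Computability.AlgebraicComplexity MvPolynomial
open Summit.ValiantsHypothesis.Theorems.DetqpThesis.Negative (qpBound_comp_le)

/-- **S4 — qp ∘ poly = qp glue** (line `Sketch`, idea `four-dimensional-determinant`).  If `g`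
is a p-projection of the permanent family `(perPoly (Fin n) ℂ)ₙ` and `n ↦ dc(gₙ)` is not
quasi-polynomially bounded, then `n ↦ dc(perₙ)` is not quasi-polynomially bounded, i.e. the crux
`DetQP.DetqpThesis` holds: from a qp bound `dc(perₘ) ≤ 2^((log₂ m + c)^c)` and the p-bounded
reindexing `t` of the p-projection, `dc(gₙ) ≤ dc(per_{t n}) ≤ 2^((log₂ (t n) + c)^c) ≤
2^((log₂ n + c')^c')` (`determinantalComplexity_le_of_isProjection_holds`, Bürgisser 2000,
§2.5; `qpBound_comp_le`), contradicting `hX`. [folklore] -/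
theorem stub_detqpThesis_of_isPProjection (σ : ℕ → Type) (g : ∀ n, MvPolynomial (σ n) ℂ)
    (hg : IsPProjection g (fun n => perPoly (Fin n) ℂ))
    (hX : ¬ IsQPBounded (fun n => determinantalComplexity (g n))) :
    Summit.ValiantsHypothesis.ValiantsHypothesis.Theses.DetQP.DetqpThesis := by
  rintro ⟨c, hc⟩
  obtain ⟨t, ht, hproj⟩ := hg
  obtain ⟨c', hc'⟩ := qpBound_comp_le ht c
  exact hX ⟨c', fun n =>
    ((determinantalComplexity_le_of_isProjection_holds (hproj n)).trans (hc (t n))).trans (hc' n)⟩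

end Summit.ValiantsHypothesis.ValiantsHypothesis.Theorems.DetQPDetqpThesis

end
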